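import Literature.NumberTheory.Transcendental.EllIterRepShuffle
import Summits.KontsevichZagierPeriods.KontsevichZagierPeriods.Theorems.RootDecompZetaThreeFrontierGZLadderLeTwo
import Summits.KontsevichZagierPeriods.KontsevichZagierPeriods.Theorems.RootDecompZetaThreeFrontierWordMatchPreludeP10
import Summits.KontsevichZagierPeriods.KontsevichZagierPeriods.Theorems.RootDecompZetaThreeFrontierWordEdge
import Summits.KontsevichZagierPeriods.KontsevichZagierPeriods.Theorems.RootDecompZetaThreeFrontierWordMovesPole
import HarnessLib
import Summits.KontsevichZagierPeriods.KontsevichZagierPeriods.Theorems.RootDecompZetaThreeFrontierGZLadderThreeWlog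
import Summits.KontsevichZagierPeriods.KontsevichZagierPeriods.Theorems.RootDecompZetaThreeFrontierRungFourPreludeP14

/-! # `RootDecompZetaThreeFrontierGZLadderFourPolarP01` — part 1/12 of the mechanical ≤400-line split of `l4_src.lean` (sha256 5cc5a9ee4c47da9a…)
Source: decomp-kz lens-1 g13 Layer4_v1.lean @897236f9 minus the RungFour prelude block (imported from …RungFourPreludeP14); --supports stmt-KontsevichZagierPeriods-27141.
Split by census-1 g10 `gen/splitlean.py`: scopes re-opened with their `open`/`variable`/`set_option` context; mathematics and declaration order unchanged. -/

/-! # (A₄) FRAME + S1 + MATCH₄ GLUE + E₄ + N₄ + S₄ + L₄⁰ (decomp-kz lens-1 g13 `Layer4_v1.lean` @897236f9): `PolarReduction 4 ⟸ MATCH₄ ∧ LAYER₄`,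
with the analytic wlog `wlog_four`, the gap form `gapFormFour`, the orders `ordersFour`, class integrability `gapClassIntegrableFour`, MATCH₄ and the
first LAYER₄ engines (four IBP directions + two disposals) PROVED; the `RungFour` prelude is imported from the landed `…RungFourPreludeP01–P14`.
Critic CLEARED g7-4 (l.1393), g7-5b (l.1398), g7-8 (l.1410); --supports stmt-KontsevichZagierPeriods-27141. -/

set_option linter.dupNamespace false

/-!
# (A₄) step S1 — the ANALYTIC WLOG in dimension 4: `wlog_four : IsGZ 4 r → IsReducedFour r`

decomp-kz lens-1 g13 (after `CellZeta 4`).  Port of the landed dimension-3 argument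
(`…Theorems.RootDecompZetaThreeFrontierWordFacesThreeP1–P3`: `face_lemma3`, the involutions `τ₁₂ τ₀₁ σ₃`, `faces3_cancel`,
`isReduced_of_isGZ_three` = `gz_ladder.stub_three_wlog`) to `Δ₄`: integrability on `Δ₄` forces the FIVE face factors
`t₃^{b₃}`, `(t₂-t₃)^{a₂₃}`, `(t₁-t₂)^{a₁₂}`, `(t₀-t₁)^{a₀₁}`, `(1-t₀)^{c₀}` of a genus-zero integrand to cancel into the numerator, so a
genus-zero datum of dimension 4 is a REDUCED one: poles only on the nine non-adjacent chords
`t₀ t₁ t₂ (1-t₁) (1-t₂) (1-t₃) (t₀-t₂) (t₀-t₃) (t₁-t₃)`.  This is stub S1 `wlog_four` of the (A₄) skeleton (RUNG4 §21 (5)).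
-/

noncomputable section

set_option linter.dupNamespace false
set_option linter.unusedVariables false
set_option linter.unusedSectionVars false
set_option linter.unusedSimpArgs false

open Set MeasureTheory MvPolynomial
open Literature.NumberTheory.Transcendental
open Summit.KontsevichZagierPeriods.KontsevichZagierPeriods.Theorems.RootDecompZetaThreeFrontierWordMoves

namespace Summit.KontsevichZagierPeriods.KontsevichZagierPeriods.Cruxes.GZNormalFormWThree.GZLadder.WlogFour

/-! ## §W1 Sections along the last coordinate (generic `N`; public copies of the landed private helpers) -/

/-- Auxiliary step `continuous_snoc` (§W1): continuous snoc. [bookkeeping] -/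
private theorem continuous_snoc {N : ℕ} (x : Fin N → ℝ) :
    Continuous fun t : ℝ => (Fin.snoc x t : Fin (N + 1) → ℝ) := by
  refine continuous_pi fun j => ?_
  refine Fin.lastCases ?_ (fun i => ?_) j
  · simpa using continuous_id'
  · simpa using continuous_const

/-- Auxiliary step `exists_measurableEquiv_snoc` (§W1): exists measurable Equiv snoc. [bookkeeping] -/
private theorem exists_measurableEquiv_snoc (N : ℕ) :
    ∃ e : (Fin (N + 1) → ℝ) ≃ᵐ (Fin N → ℝ) × ℝ,
      MeasurePreserving e volume ((volume : Measure (Fin N → ℝ)).prod (volume : Measure ℝ)) ∧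
      ∀ q, e.symm q = Fin.snoc q.1 q.2 := by
  refine ⟨(MeasurableEquiv.piFinSuccAbove (fun _ => ℝ) (Fin.last N)).trans
    MeasurableEquiv.prodComm, ?_, fun q => ?_⟩
  · refine (volume_preserving_piFinSuccAbove (fun _ => ℝ) (Fin.last N)).trans ?_
    rw [Measure.volume_eq_prod]
    exact Measure.measurePreserving_swap
  · show (MeasurableEquiv.piFinSuccAbove (fun _ => ℝ) (Fin.last N)).symm (q.2, q.1) = _
    rw [MeasurableEquiv.piFinSuccAbove_symm_apply, Fin.insertNthEquiv_last]
    rfl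

/-- Auxiliary step `ae_integrableOn_snoc` (§W1): ae integrable On snoc. [bookkeeping] -/
theorem ae_integrableOn_snoc {N : ℕ} {B : Set (Fin (N + 1) → ℝ)} (hB : MeasurableSet B)
    {f : (Fin (N + 1) → ℝ) → ℝ} (hf : IntegrableOn f B) :
    ∀ᵐ x : Fin N → ℝ, IntegrableOn (fun t : ℝ => f (Fin.snoc x t))
      {t | (Fin.snoc x t : Fin (N + 1) → ℝ) ∈ B} := by
  obtain ⟨e, he, he_symm⟩ := exists_measurableEquiv_snoc N
  have h1 : Integrable (B.indicator f) volume := (integrable_indicator_iff hB).2 hf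
  have h2 : Integrable (B.indicator f ∘ e.symm) ((volume : Measure (Fin N → ℝ)).prod volume) :=
    ((he.symm e).integrable_comp_emb e.symm.measurableEmbedding).2 h1
  refine (h2.prod_right_ae).mono fun x hx => ?_
  have hm : MeasurableSet {t : ℝ | (Fin.snoc x t : Fin (N + 1) → ℝ) ∈ B} :=
    (continuous_snoc x).measurable hB
  refine (integrable_indicator_iff hm).1 (hx.congr (Filter.Eventually.of_forall fun t => ?_))
  show (B.indicator f ∘ e.symm) (x, t) = _
  rw [Function.comp_apply, he_symm]
  exact (Set.indicator_comp_right (fun t : ℝ => (Fin.snoc x t : Fin (N + 1) → ℝ)) (g := f)).symm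

/-- Auxiliary step `snoc3_zero` (§W1): snoc3 zero. [bookkeeping] -/
theorem snoc3_zero (x : Fin 3 → ℝ) (t : ℝ) : (Fin.snoc x t : Fin 4 → ℝ) 0 = x 0 := rfl
/-- Auxiliary step `snoc3_one` (§W1): snoc3 one. [bookkeeping] -/
theorem snoc3_one (x : Fin 3 → ℝ) (t : ℝ) : (Fin.snoc x t : Fin 4 → ℝ) 1 = x 1 := rfl
/-- Auxiliary step `snoc3_two` (§W1): snoc3 two. [bookkeeping] -/
theorem snoc3_two (x : Fin 3 → ℝ) (t : ℝ) : (Fin.snoc x t : Fin 4 → ℝ) 2 = x 2 := rfl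
/-- Auxiliary step `snoc3_three` (§W1): snoc3 three. [bookkeeping] -/
theorem snoc3_three (x : Fin 3 → ℝ) (t : ℝ) : (Fin.snoc x t : Fin 4 → ℝ) 3 = t := rfl

/-! ## §W2 The last row `P(X₀,X₁,X₂,0)` of a `Fin 4` polynomial -/

/-- Auxiliary step `aeval_eq_sum_four` (§W2): aeval eq sum four. [bookkeeping] -/
theorem aeval_eq_sum_four (p : MvPolynomial (Fin 4) ℚ) (t : Fin 4 → ℝ) :
    MvPolynomial.aeval t p =
      ∑ m ∈ p.support, ((MvPolynomial.coeff m p : ℚ) : ℝ) * (t 0 ^ (m 0) * t 1 ^ (m 1) * t 2 ^ (m 2) * t 3 ^ (m 3)) := by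
  rw [MvPolynomial.aeval_def, MvPolynomial.eval₂_eq']
  refine Finset.sum_congr rfl fun m _ => ?_
  simp [Fin.prod_univ_four, eq_ratCast]

/-- the first three exponents of a `Fin 4` exponent -/
def init4 (e : Fin 4 →₀ ℕ) : Fin 3 →₀ ℕ := Finsupp.single 0 (e 0) + Finsupp.single 1 (e 1) + Finsupp.single 2 (e 2)

/-- Auxiliary step `init4_zero` (§W2): init4 zero. [bookkeeping] -/
theorem init4_zero (e : Fin 4 →₀ ℕ) : init4 e 0 = e 0 := by simp [init4]
/-- Auxiliary step `init4_one` (§W2): init4 one. [bookkeeping] -/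
theorem init4_one (e : Fin 4 →₀ ℕ) : init4 e 1 = e 1 := by simp [init4]
/-- Auxiliary step `init4_two` (§W2): init4 two. [bookkeeping] -/
theorem init4_two (e : Fin 4 →₀ ℕ) : init4 e 2 = e 2 := by simp [init4]

/-- the LAST ROW `P(X₀, X₁, X₂, 0)` -/
def rowLast4 (P : MvPolynomial (Fin 4) ℚ) : MvPolynomial (Fin 3) ℚ :=
  ∑ e ∈ P.support with e 3 = 0, MvPolynomial.monomial (init4 e) (MvPolynomial.coeff e P)

/-- Auxiliary step `aeval_rowLast4` (§W2): aeval row Last4. [bookkeeping] -/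
theorem aeval_rowLast4 (P : MvPolynomial (Fin 4) ℚ) (x : Fin 3 → ℝ) :
    MvPolynomial.aeval (Fin.snoc x (0:ℝ) : Fin 4 → ℝ) P = MvPolynomial.aeval x (rowLast4 P) := by
  rw [aeval_eq_sum_four, rowLast4, map_sum, Finset.sum_filter]
  refine Finset.sum_congr rfl fun e _ => ?_
  split_ifs with h
  · rw [MvPolynomial.aeval_monomial, Finsupp.prod_pow, Fin.prod_univ_three, init4_zero, init4_one, init4_two, snoc3_zero,
      snoc3_one, snoc3_two, snoc3_three, h, pow_zero, mul_one, eq_ratCast]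
  · rw [snoc3_three, zero_pow h, mul_zero, mul_zero]

/-- Auxiliary step `rowLast4_ne_zero` (§W2): row Last4 ne zero. [bookkeeping] -/
theorem rowLast4_ne_zero (P : MvPolynomial (Fin 4) ℚ) {e₀ : Fin 4 →₀ ℕ} (he₀ : e₀ ∈ P.support) (h3 : e₀ 3 = 0) :
    rowLast4 P ≠ 0 := by
  classical
  intro h0
  have hc : MvPolynomial.coeff (init4 e₀) (rowLast4 P) = MvPolynomial.coeff e₀ P := by
    rw [rowLast4, MvPolynomial.coeff_sum]
    have key : ∀ e ∈ P.support.filter (fun e : Fin 4 →₀ ℕ => e 3 = 0),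
        MvPolynomial.coeff (init4 e₀) (MvPolynomial.monomial (init4 e) (MvPolynomial.coeff e P)) =
          if e = e₀ then MvPolynomial.coeff e P else 0 := by
      intro e he
      have he3 : e 3 = 0 := (Finset.mem_filter.1 he).2
      rw [MvPolynomial.coeff_monomial]
      have hiff : (init4 e = init4 e₀) ↔ e = e₀ := by
        constructor
        · intro h
          have h0' : e 0 = e₀ 0 := by
            have := DFunLike.congr_fun h 0
            rwa [init4_zero, init4_zero] at this
          have h1' : e 1 = e₀ 1 := by
            have := DFunLike.congr_fun h 1
            rwa [init4_one, init4_one] at this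
          have h2' : e 2 = e₀ 2 := by
            have := DFunLike.congr_fun h 2
            rwa [init4_two, init4_two] at this
          ext j
          fin_cases j
          · exact h0'
          · exact h1'
          · exact h2'
          · show e 3 = e₀ 3
            rw [he3, h3]
        · intro h
          rw [h]
      simp only [hiff]
    rw [Finset.sum_congr rfl key, Finset.sum_ite_eq', if_pos (Finset.mem_filter.2 ⟨he₀, h3⟩)]
  rw [h0, MvPolynomial.coeff_zero] at hc
  exact (MvPolynomial.mem_support_iff.1 he₀) hc.symm

/-! ## §W3 THE FACE LEMMA IN DIMENSION 4 (verbatim port of `face_lemma3`) -/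

/-- Auxiliary step `face_lemma4` (§W3): face lemma4. [bookkeeping] -/
theorem face_lemma4 {B : Set (Fin 4 → ℝ)} (hB : MeasurableSet B) (hB3 : ∀ y ∈ B, y 3 ≠ 0)
    {A : Set (Fin 3 → ℝ)} (hA : IsOpen A) (hAne : A.Nonempty) (ℓ : (Fin 3 → ℝ) → ℝ)
    (hsec : ∀ x ∈ A, {t : ℝ | (Fin.snoc x t : Fin 4 → ℝ) ∈ B} = Ioo 0 (ℓ x))
    (hℓ : ∀ x ∈ A, 0 < ℓ x ∧ ℓ x ≤ 1) (D : (Fin 4 → ℝ) → ℝ)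
    (hDc : ∀ x ∈ A, ContinuousAt (fun s : ℝ => D (Fin.snoc x s)) 0)
    (hD0 : ∀ x ∈ A, D (Fin.snoc x (0:ℝ)) ≠ 0) :
    ∀ (b : ℕ) (P : MvPolynomial (Fin 4) ℚ),
      IntegrableOn (fun y => MvPolynomial.aeval y P / (y 3 ^ b * D y)) B → ∀ e ∈ P.support, b ≤ e 3 := by
  intro b
  induction b with
  | zero => exact fun P _ e _ => Nat.zero_le _
  | succ b ih =>
    intro P hP
    have hrow : ∀ e ∈ P.support, 1 ≤ e 3 := by
      by_contra hne
      push Not at hne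
      obtain ⟨e₀, he₀, he₀3⟩ := hne
      have hR : rowLast4 P ≠ 0 := rowLast4_ne_zero P he₀ (Nat.lt_one_iff.1 he₀3)
      have hae := ae_integrableOn_snoc hB hP
      refine false_of_ae_of_forall_not hae (S := A ∩ {x | MvPolynomial.aeval x (rowLast4 P) ≠ 0})
        (fun x hx h => ?_) (volume_aeval_ne_zero hA hAne hR)
      obtain ⟨hxA, hxR⟩ := hx
      rw [hsec x hxA] at h
      have hMc : ContinuousAt
          (fun t : ℝ => MvPolynomial.aeval (Fin.snoc x t : Fin 4 → ℝ) P / D (Fin.snoc x t)) 0 :=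
        ((continuous_aeval_fin P).comp (continuous_snoc x)).continuousAt.div₀ (hDc x hxA) (hD0 x hxA)
      have hM0 : (fun t : ℝ => MvPolynomial.aeval (Fin.snoc x t : Fin 4 → ℝ) P / D (Fin.snoc x t)) 0 ≠ 0 := by
        refine div_ne_zero ?_ (hD0 x hxA)
        rw [aeval_rowLast4]
        exact hxR
      obtain ⟨η, hη, hη1, hMη⟩ := abs_ge_near_zero hMc hM0
      have hη' : 0 < min η (ℓ x) := lt_min hη (hℓ x hxA).1
      refine not_integrableOn_pole (half_pos (abs_pos.2 hM0)) hη' ((min_le_left _ _).trans hη1)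
        (Nat.succ_le_succ b.zero_le) (fun y hy => hMη y ⟨hy.1, hy.2.trans_le (min_le_left _ _)⟩)
        ((h.mono_set (Ioo_subset_Ioo_right (min_le_right _ _))).congr_fun (fun t _ => ?_) measurableSet_Ioo)
      show MvPolynomial.aeval (Fin.snoc x t : Fin 4 → ℝ) P /
          ((Fin.snoc x t : Fin 4 → ℝ) 3 ^ (b + 1) * D (Fin.snoc x t)) =
        MvPolynomial.aeval (Fin.snoc x t : Fin 4 → ℝ) P / D (Fin.snoc x t) / t ^ (b + 1)
      rw [div_div, mul_comm (D _)]
      rfl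
    obtain ⟨P', rfl⟩ := exists_X_pow_mul_fin 3 1 P hrow
    have hP' : IntegrableOn (fun y => MvPolynomial.aeval y P' / (y 3 ^ b * D y)) B := by
      refine hP.congr_fun (fun y hy => ?_) hB
      show MvPolynomial.aeval y (MvPolynomial.X 3 ^ 1 * P') / (y 3 ^ (b + 1) * D y) =
        MvPolynomial.aeval y P' / (y 3 ^ b * D y)
      rw [map_mul, map_pow, MvPolynomial.aeval_X, pow_one, pow_succ', mul_assoc, mul_div_mul_left _ _ (hB3 y hy)]
    have ih' := ih P' hP'
    intro e he
    obtain ⟨h1, he'⟩ := le_of_mem_support_X_pow_mul_fin 3 1 P' e he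
    have := ih' _ he'
    simp only [Finsupp.coe_tsub, Pi.sub_apply, Finsupp.single_eq_same] at this
    omega

/-! ## §W4 Transport of integrability by linear involutions of `Δ₄` -/

/-- Auxiliary step `integrableOn_comp_invol4` (§W4): integrable On comp invol4. [bookkeeping] -/
theorem integrableOn_comp_invol4 {Φ : (Fin 4 → ℝ) → (Fin 4 → ℝ)} {L : (Fin 4 → ℝ) →L[ℝ] (Fin 4 → ℝ)}
    (hd : ∀ x, HasFDerivAt Φ L x) (hL : |L.det| = 1) (hinv : ∀ z, Φ (Φ z) = z)
    (hmem : ∀ z ∈ KZ.openOrderedSimplex 4, Φ z ∈ KZ.openOrderedSimplex 4)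
    {F : (Fin 4 → ℝ) → ℝ} (hF : IntegrableOn F (KZ.openOrderedSimplex 4)) :
    IntegrableOn (fun z => F (Φ z)) (KZ.openOrderedSimplex 4) := by
  have hm := measurableSet_simplex 4
  have himage : Φ '' KZ.openOrderedSimplex 4 = KZ.openOrderedSimplex 4 := by
    ext u
    constructor
    · rintro ⟨z, hz, rfl⟩
      exact hmem z hz
    · intro hu
      exact ⟨Φ u, hmem u hu, hinv u⟩
  have key := (integrableOn_image_iff_integrableOn_abs_det_fderiv_smul (μ := volume) hm
    (fun x _ => (hd x).hasFDerivWithinAt) (fun a _ b _ h => by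
      have := congrArg Φ h
      rwa [hinv, hinv] at this) (fun z => F (Φ z))).2
    (hF.congr_fun (fun p _ => by simp [hL, hinv]) hm)
  rwa [himage] at key

/-- Auxiliary step `abs_det_of_invol4` (§W4): abs det of invol4. [bookkeeping] -/
private theorem abs_det_of_invol4 {L : (Fin 4 → ℝ) →L[ℝ] (Fin 4 → ℝ)} (h : ∀ w, L (L w) = w) : |L.det| = 1 := by
  have hcomp : (L : (Fin 4 → ℝ) →ₗ[ℝ] (Fin 4 → ℝ)) ∘ₗ (L : (Fin 4 → ℝ) →ₗ[ℝ] (Fin 4 → ℝ)) = LinearMap.id := by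
    apply LinearMap.ext
    intro w
    simp [h]
  have h1 := congrArg LinearMap.det hcomp
  rw [LinearMap.det_comp, LinearMap.det_id] at h1
  have h2 : |LinearMap.det (L : (Fin 4 → ℝ) →ₗ[ℝ] (Fin 4 → ℝ))| ^ 2 = 1 := by
    rw [sq_abs, sq, h1]
  exact (pow_eq_one_iff_of_nonneg (abs_nonneg _) two_ne_zero).1 h2

/-! ## §W5 `Δ₄`, `Δ₃`: membership, sections, positivity of the fourteen forms -/

/-- Auxiliary step `mem_simplex_four_iff` (§W5): mem simplex four iff. [bookkeeping] -/
private theorem mem_simplex_four_iff (t : Fin 4 → ℝ) :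
    t ∈ KZ.openOrderedSimplex 4 ↔ 0 < t 3 ∧ t 3 < t 2 ∧ t 2 < t 1 ∧ t 1 < t 0 ∧ t 0 < 1 := by
  constructor
  · rintro ⟨h0, h1, ha⟩
    exact ⟨h0 3, ha (show (2 : Fin 4) < 3 by decide), ha (show (1 : Fin 4) < 2 by decide),
      ha (show (0 : Fin 4) < 1 by decide), h1 0⟩
  · rintro ⟨h3, h32, h21, h10, h0⟩
    have hsa : StrictAnti t := by
      refine Fin.strictAnti_iff_succ_lt.mpr fun i => ?_
      fin_cases i
      · simpa using h10
      · simpa using h21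
      · simpa using h32
    exact ⟨fun i => lt_of_lt_of_le h3 (hsa.antitone (Fin.le_last i)),
      fun i => lt_of_le_of_lt (hsa.antitone (Fin.le_iff_val_le_val.2 (Nat.zero_le _))) h0, hsa⟩

/-- Auxiliary step `simplex_three_nonempty` (§W5): simplex three nonempty. [bookkeeping] -/
theorem simplex_three_nonempty : (KZ.openOrderedSimplex 3).Nonempty :=
  ⟨![3 / 4, 1 / 2, 1 / 4], (mem_simplex_three_iff _).2 (by simp; norm_num)⟩

/-- Auxiliary step `snoc_section_four` (§W5): snoc section four. [bookkeeping] -/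
theorem snoc_section_four {x : Fin 3 → ℝ} (hx : x ∈ KZ.openOrderedSimplex 3) :
    {t : ℝ | (Fin.snoc x t : Fin 4 → ℝ) ∈ KZ.openOrderedSimplex 4} = Ioo 0 (x 2) := by
  obtain ⟨hx2, hx21, hx10, hx0⟩ := (mem_simplex_three_iff x).1 hx
  ext t
  rw [mem_setOf_eq, mem_simplex_four_iff, snoc3_zero, snoc3_one, snoc3_two, snoc3_three, mem_Ioo]
  exact ⟨fun h => ⟨h.1, h.2.1⟩, fun h => ⟨h.1, h.2, hx21, hx10, hx0⟩⟩

/-- Auxiliary step `section_base` (§W5): section base. [bookkeeping] -/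
theorem section_base {x : Fin 3 → ℝ} (hx : x ∈ KZ.openOrderedSimplex 3) : 0 < x 2 ∧ x 2 ≤ 1 := by
  obtain ⟨hx2, hx21, hx10, hx0⟩ := (mem_simplex_three_iff x).1 hx
  exact ⟨hx2, by linarith⟩

/-- Auxiliary step `gz4_denoms_pos` (§W5): gz4 denoms pos. [bookkeeping] -/
theorem gz4_denoms_pos {t : Fin 4 → ℝ} (ht : t ∈ KZ.openOrderedSimplex 4) :
    0 < t 0 ∧ 0 < t 1 ∧ 0 < t 2 ∧ 0 < t 3 ∧ 0 < 1 - t 0 ∧ 0 < 1 - t 1 ∧ 0 < 1 - t 2 ∧ 0 < 1 - t 3 ∧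
      0 < t 0 - t 1 ∧ 0 < t 0 - t 2 ∧ 0 < t 0 - t 3 ∧ 0 < t 1 - t 2 ∧ 0 < t 1 - t 3 ∧ 0 < t 2 - t 3 := by
  obtain ⟨h3, h32, h21, h10, h0⟩ := (mem_simplex_four_iff t).1 ht
  exact ⟨by linarith, by linarith, by linarith, h3, by linarith, by linarith, by linarith, by linarith, by linarith,
    by linarith, by linarith, by linarith, by linarith, by linarith⟩

end Summit.KontsevichZagierPeriods.KontsevichZagierPeriods.Cruxes.GZNormalFormWThree.GZLadder.WlogFour

namespace Summit.KontsevichZagierPeriods.KontsevichZagierPeriods.Cruxes.GZNormalFormWThree.GZLadder.WlogFour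

/-! ## §W6 The four linear involutions of `Δ₄` exchanging a face with `t₃ = 0`, and the matching substitutions on polynomials -/

/-- the coordinate projections of `ℝ⁴` -/
abbrev Pj4 (i : Fin 4) : (Fin 4 → ℝ) →L[ℝ] ℝ := ContinuousLinearMap.proj (R := ℝ) (φ := fun _ : Fin 4 => ℝ) i

/-- `τ₂₃(t) = (t₀, t₁, t₂, t₂ - t₃)` (exchanges the faces `t₃ = 0` and `t₂ = t₃`) -/
def s23 (z : Fin 4 → ℝ) : Fin 4 → ℝ := ![z 0, z 1, z 2, z 2 - z 3]
/-- its linear part -/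
def s23L : (Fin 4 → ℝ) →L[ℝ] (Fin 4 → ℝ) := ContinuousLinearMap.pi ![Pj4 0, Pj4 1, Pj4 2, Pj4 2 - Pj4 3]

/-- Auxiliary step `s23_zero` (§W6): s23 zero. [bookkeeping] -/
theorem s23_zero (z : Fin 4 → ℝ) : s23 z 0 = z 0 := by simp [s23]
/-- Auxiliary step `s23_one` (§W6): s23 one. [bookkeeping] -/
theorem s23_one (z : Fin 4 → ℝ) : s23 z 1 = z 1 := by simp [s23]
/-- Auxiliary step `s23_two` (§W6): s23 two. [bookkeeping] -/
theorem s23_two (z : Fin 4 → ℝ) : s23 z 2 = z 2 := by simp [s23]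
/-- Auxiliary step `s23_three` (§W6): s23 three. [bookkeeping] -/
theorem s23_three (z : Fin 4 → ℝ) : s23 z 3 = z 2 - z 3 := by simp [s23]

/-- Auxiliary step `s23_eq_L` (§W6): s23 eq L. [bookkeeping] -/
theorem s23_eq_L (z : Fin 4 → ℝ) : s23 z = s23L z := by
  funext i
  fin_cases i <;> simp [s23, s23L]

/-- Auxiliary step `s23_s23` (§W6): s23 s23. [bookkeeping] -/
theorem s23_s23 (z : Fin 4 → ℝ) : s23 (s23 z) = z := by
  funext i
  fin_cases i <;> simp [s23_zero, s23_one, s23_two, s23_three]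

/-- Auxiliary step `s23L_s23L` (§W6): s23 L s23 L. [bookkeeping] -/
theorem s23L_s23L (w : Fin 4 → ℝ) : s23L (s23L w) = w := by
  rw [← s23_eq_L, ← s23_eq_L, s23_s23]

/-- Auxiliary step `hasFDerivAt_s23` (§W6): has FDeriv At s23. [bookkeeping] -/
theorem hasFDerivAt_s23 (x : Fin 4 → ℝ) : HasFDerivAt s23 s23L x := by
  have e : s23 = fun z => s23L z := funext s23_eq_L
  rw [e]
  exact s23L.hasFDerivAt

/-- Auxiliary step `abs_det_s23L` (§W6): abs det s23 L. [bookkeeping] -/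
theorem abs_det_s23L : |s23L.det| = 1 := abs_det_of_invol4 s23L_s23L

/-- Auxiliary step `mem_simplex_four_s23` (§W6): mem simplex four s23. [bookkeeping] -/
theorem mem_simplex_four_s23 {z : Fin 4 → ℝ} (hz : z ∈ KZ.openOrderedSimplex 4) : s23 z ∈ KZ.openOrderedSimplex 4 := by
  rw [mem_simplex_four_iff] at hz ⊢
  rw [s23_zero, s23_one, s23_two, s23_three]
  obtain ⟨h3, h32, h21, h10, h0⟩ := hz
  exact ⟨by linarith, by linarith, by linarith, by linarith, by linarith⟩

/-- `F` integrable on `Δ₄` ⟹ `F ∘ s23` integrable on `Δ₄` -/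
theorem integrableOn_comp_s23 {F : (Fin 4 → ℝ) → ℝ} (hF : IntegrableOn F (KZ.openOrderedSimplex 4)) :
    IntegrableOn (fun z => F (s23 z)) (KZ.openOrderedSimplex 4) :=
  integrableOn_comp_invol4 hasFDerivAt_s23 abs_det_s23L s23_s23 (fun _ hz => mem_simplex_four_s23 hz) hF

/-- the substitution `P ↦ P ∘ s23` on polynomials -/
def s23P : MvPolynomial (Fin 4) ℚ →ₐ[ℚ] MvPolynomial (Fin 4) ℚ :=
  MvPolynomial.bind₁ ![MvPolynomial.X 0, MvPolynomial.X 1, MvPolynomial.X 2, MvPolynomial.X 2 - MvPolynomial.X 3]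

/-- Auxiliary step `s23P_s23P` (§W6): s23 P s23 P. [bookkeeping] -/
theorem s23P_s23P (p : MvPolynomial (Fin 4) ℚ) : s23P (s23P p) = p := by
  have h : s23P.comp s23P = AlgHom.id ℚ _ := MvPolynomial.algHom_ext fun i => by
    fin_cases i <;> simp [s23P, MvPolynomial.bind₁_X_right, sub_sub_cancel]
  exact AlgHom.congr_fun h p

/-- Auxiliary step `aeval_s23P` (§W6): aeval s23 P. [bookkeeping] -/
theorem aeval_s23P (p : MvPolynomial (Fin 4) ℚ) (t : Fin 4 → ℝ) :
    MvPolynomial.aeval t (s23P p) = MvPolynomial.aeval (s23 t) p := by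
  have e : (fun i => MvPolynomial.aeval t
      ((![MvPolynomial.X 0, MvPolynomial.X 1, MvPolynomial.X 2, MvPolynomial.X 2 - MvPolynomial.X 3] :
        Fin 4 → MvPolynomial (Fin 4) ℚ) i)) = s23 t := by
    funext i
    fin_cases i <;> simp [s23_zero, s23_one, s23_two, s23_three]
  rw [s23P, MvPolynomial.aeval_bind₁, e]

/-- `τ₁₂(t) = (t₀, t₁, t₁ - t₃, t₁ - t₂)` (exchanges the faces `t₃ = 0` and `t₁ = t₂`) -/
def s13 (z : Fin 4 → ℝ) : Fin 4 → ℝ := ![z 0, z 1, z 1 - z 3, z 1 - z 2]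
/-- its linear part -/
def s13L : (Fin 4 → ℝ) →L[ℝ] (Fin 4 → ℝ) := ContinuousLinearMap.pi ![Pj4 0, Pj4 1, Pj4 1 - Pj4 3, Pj4 1 - Pj4 2]

end Summit.KontsevichZagierPeriods.KontsevichZagierPeriods.Cruxes.GZNormalFormWThree.GZLadder.WlogFour
end
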